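import Mathlib
import Summits.Ventures.PercRepro2.Defs
import Summits.Ventures.PercRepro2.Independence
import Summits.Ventures.PercRepro2.Harris
import Summits.Ventures.PercRepro2.Graph
import Summits.Ventures.PercRepro2.Exploration
import Summits.Ventures.PercRepro2.Events
import Summits.Ventures.PercRepro2.Induced
import Summits.Ventures.PercRepro2.BHK
import Summits.Ventures.PercRepro2.BHKEvents
import Summits.Ventures.PercRepro2.OneEdge
import Summits.Ventures.PercRepro2.RBRoot
import Summits.Ventures.PercRepro2.RBRootEdge
import Summits.Ventures.PercRepro2.RBRootEdgePin
import Summits.Ventures.PercRepro2.RBRootEdgeMain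
import Summits.Ventures.PercRepro2.RBRootEdgeT
import Summits.Ventures.PercRepro2.RBRootIsolated
import Summits.Ventures.PercRepro2.RBTwoMarkers
import Summits.Ventures.PercRepro2.RBTwoMarkersMain
import Summits.Ventures.PercRepro2.RBTwoMarkersCross
import Summits.Ventures.PercRepro2.RBTwoMarkersCrossMain

/-!
# Row 2′RB at every third vertex whose neighbours are roots and markers (mine-a g5; MINE-A.md §30–§32 (b))

The kernel theorem `rb_of_skeleton`: let `w ∉ {s, t, b, o}` and let every edge of nonzero weight
at `w` end in `{s, t, b, o}`, with at most one such edge to `b` and at most one to `o` (the root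
edges may have any multiplicity). Then both forms of the row hold at `w`:
`(RB-cross)` `rbSum p (bL, oH) ≤ P(Q ∩ bL) P(Q ∩ oH) / P(Q)` and
`(RB-same)` `P(Q ∩ bL) P(Q ∩ oL) / P(Q) ≤ rbSum p (bL, oL)`.

Proof: the root edges at `w` are set to weight `0` one at a time (`cross_of_zero_roots`,
`same_of_zero_roots`, a `Finset` induction over `RBRootEdge.cross_of_update(_t)` /
`same_of_update(_t)`); what remains is a third vertex whose edges of nonzero weight go to the
markers only (`rb_of_markers`): two markers — `RBTwoMarkers.cross_two_markers_of_zero` /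
`same_two_markers_of_zero`; one marker — `cross_one_marker(_o)` / `same_one_marker(_o)` (pin the
marker edge: the open pattern collapses at the marker and is BHK 1.4 / 1.3 on `G − w`, the closed
pattern is the isolated case); no marker — `RBRoot.cross_isolated` / `same_isolated`.
-/

namespace Summit.Ventures.PercRepro2

namespace RBKernel

open scoped Classical

section Kernel

variable {V : Type*} {E : Type*} [Fintype E] [DecidableEq E] [Fintype V] {R : Type*} [Field R]
  [LinearOrder R] [IsStrictOrderedRing R] (ends : E → Sym2 V) (s t w : V)

/-- **(RB-cross) at a third vertex whose only edge of nonzero weight is the marker edge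
`e₁ = {w, b}`**: pinning `e₁`, the open pattern collapses at `b` to `P(Q ∩ bL ∩ oH)` and is BHK 1.4
on `G − w`; the closed pattern is the isolated case. -/
theorem cross_one_marker {p : E → R} (hp : IsProbVec p) {e₁ : E} {b : V} (o : V)
    (hz : ∀ e, w ∈ ends e → e ≠ e₁ → p e = 0) (hends₁ : ends e₁ = s(w, b)) (hws : s ≠ w)
    (hwt : t ≠ w) (hwb : b ≠ w) (hwo : o ≠ w) :
    RBRoot.rbSum p ends s t w (connEvent ends b s) (connEvent ends o t) ≤
      prob p ((connEvent ends s t)ᶜ ∩ connEvent ends b s) *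
        prob p ((connEvent ends s t)ᶜ ∩ connEvent ends o t) / prob p (connEvent ends s t)ᶜ := by
  have hz' : ∀ e, w ∈ ends e ∧ e ≠ e₁ → p e = 0 := fun e he => hz e he.1 he.2
  obtain ⟨-, -, -, -, -, L1d⟩ :=
    RBTwoMarkers.prob_leaf_update_events ends w p hz' hends₁ s t b o hws hwt hwb hwo 1 (Or.inr rfl)
  obtain ⟨L0a, L0b, -, L0c, -, -⟩ :=
    RBTwoMarkers.prob_leaf_update_events ends w p hz' hends₁ s t b o hws hwt hwb hwo 0 (Or.inl rfl)
  have hiso : ∀ e, w ∈ ends e → Function.update p e₁ 0 e = 0 := by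
    intro e he
    by_cases h : e = e₁
    · subst h; exact Function.update_self _ _ _
    · rw [Function.update_of_ne h]; exact hz e he h
  rw [RBTwoMarkers.rbSum_pin_cross_b ends s t w hp hends₁ o,
    RBTwoMarkers.rbSum_update_one_cross_b ends s t w p hp hends₁ o,
    RBRoot.rbSum_isolated _ ends w hiso s t, L1d, L0a, L0b, L0c]
  have hBHK := RBRoot.cross_collapsed ends hp o b s t
  have := mul_le_mul_of_nonneg_left hBHK (hp.nonneg e₁)
  linarith

/-- **(RB-same) at a third vertex whose only edge of nonzero weight is the marker edge
`e₁ = {w, b}`** (BHK 1.3 on `G − w` for the open pattern). -/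
theorem same_one_marker {p : E → R} (hp : IsProbVec p) {e₁ : E} {b : V} (o : V)
    (hz : ∀ e, w ∈ ends e → e ≠ e₁ → p e = 0) (hends₁ : ends e₁ = s(w, b)) (hws : s ≠ w)
    (hwt : t ≠ w) (hwb : b ≠ w) (hwo : o ≠ w) :
    prob p ((connEvent ends s t)ᶜ ∩ connEvent ends b s) *
        prob p ((connEvent ends s t)ᶜ ∩ connEvent ends o s) / prob p (connEvent ends s t)ᶜ ≤
      RBRoot.rbSum p ends s t w (connEvent ends b s) (connEvent ends o s) := by
  have hz' : ∀ e, w ∈ ends e ∧ e ≠ e₁ → p e = 0 := fun e he => hz e he.1 he.2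
  obtain ⟨-, -, -, -, L1d, -⟩ :=
    RBTwoMarkers.prob_leaf_update_events ends w p hz' hends₁ s t b o hws hwt hwb hwo 1 (Or.inr rfl)
  obtain ⟨L0a, L0b, L0c, -, -, -⟩ :=
    RBTwoMarkers.prob_leaf_update_events ends w p hz' hends₁ s t b o hws hwt hwb hwo 0 (Or.inl rfl)
  have hiso : ∀ e, w ∈ ends e → Function.update p e₁ 0 e = 0 := by
    intro e he
    by_cases h : e = e₁
    · subst h; exact Function.update_self _ _ _
    · rw [Function.update_of_ne h]; exact hz e he h
  rw [RBTwoMarkers.rbSum_pin_same_marker ends s t w hp hends₁ o,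
    RBTwoMarkers.rbSum_update_one_marker ends s t w p hp hends₁ o,
    RBRoot.rbSum_isolated _ ends w hiso s t, L1d, L0a, L0b, L0c]
  have hBHK := RBRoot.same_collapsed ends hp o b s t
  have := mul_le_mul_of_nonneg_left hBHK (hp.nonneg e₁)
  linarith

/-- `cross_one_marker` for the marker `o` (roots and markers renamed, `RBRootEdge.rbSum_swap`). -/
theorem cross_one_marker_o {p : E → R} (hp : IsProbVec p) {e₂ : E} {o : V} (b : V)
    (hz : ∀ e, w ∈ ends e → e ≠ e₂ → p e = 0) (hends₂ : ends e₂ = s(w, o)) (hws : s ≠ w)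
    (hwt : t ≠ w) (hwb : b ≠ w) (hwo : o ≠ w) :
    RBRoot.rbSum p ends s t w (connEvent ends b s) (connEvent ends o t) ≤
      prob p ((connEvent ends s t)ᶜ ∩ connEvent ends b s) *
        prob p ((connEvent ends s t)ᶜ ∩ connEvent ends o t) / prob p (connEvent ends s t)ᶜ := by
  have key := cross_one_marker ends t s w hp (e₁ := e₂) (b := o) b hz hends₂ hwt hws hwo hwb
  rw [RBRootEdge.rbSum_swap (p := p) ends s t w, RBRoot.compl_connEvent_comm ends t s, mul_comm] at key
  exact key

/-- `same_one_marker` for the marker `o` (`RBRoot.rbSum_comm`). -/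
theorem same_one_marker_o {p : E → R} (hp : IsProbVec p) {e₂ : E} {o : V} (b : V)
    (hz : ∀ e, w ∈ ends e → e ≠ e₂ → p e = 0) (hends₂ : ends e₂ = s(w, o)) (hws : s ≠ w)
    (hwt : t ≠ w) (hwb : b ≠ w) (hwo : o ≠ w) :
    prob p ((connEvent ends s t)ᶜ ∩ connEvent ends b s) *
        prob p ((connEvent ends s t)ᶜ ∩ connEvent ends o s) / prob p (connEvent ends s t)ᶜ ≤
      RBRoot.rbSum p ends s t w (connEvent ends b s) (connEvent ends o s) := by
  have key := same_one_marker ends s t w hp (e₁ := e₂) (b := o) b hz hends₂ hws hwt hwo hwb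
  rw [RBRoot.rbSum_comm, mul_comm] at key
  exact key

/-- **Both forms of the row at a third vertex whose edges of nonzero weight all go to the
markers**, at most one such edge to each marker: two markers (`RBTwoMarkers.*_two_markers_of_zero`),
one marker (`*_one_marker(_o)`) or none (`RBRoot.*_isolated`). -/
theorem rb_of_markers {p : E → R} (hp : IsProbVec p) (o b : V)
    (H : ∀ e, w ∈ ends e → p e ≠ 0 → ends e = s(w, b) ∨ ends e = s(w, o))
    (Hb : ∀ e e', ends e = s(w, b) → ends e' = s(w, b) → p e ≠ 0 → p e' ≠ 0 → e = e')
    (Ho : ∀ e e', ends e = s(w, o) → ends e' = s(w, o) → p e ≠ 0 → p e' ≠ 0 → e = e')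
    (hws : s ≠ w) (hwt : t ≠ w) (hwb : b ≠ w) (hwo : o ≠ w) :
    (RBRoot.rbSum p ends s t w (connEvent ends b s) (connEvent ends o t) ≤
      prob p ((connEvent ends s t)ᶜ ∩ connEvent ends b s) *
        prob p ((connEvent ends s t)ᶜ ∩ connEvent ends o t) / prob p (connEvent ends s t)ᶜ) ∧
    (prob p ((connEvent ends s t)ᶜ ∩ connEvent ends b s) *
        prob p ((connEvent ends s t)ᶜ ∩ connEvent ends o s) / prob p (connEvent ends s t)ᶜ ≤
      RBRoot.rbSum p ends s t w (connEvent ends b s) (connEvent ends o s)) := by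
  by_cases hb : ∃ e, ends e = s(w, b) ∧ p e ≠ 0
  · obtain ⟨e₁, he₁, hp₁⟩ := hb
    by_cases ho : ∃ e, ends e = s(w, o) ∧ p e ≠ 0
    · obtain ⟨e₂, he₂, hp₂⟩ := ho
      by_cases h12 : e₁ = e₂
      · have hz : ∀ e, w ∈ ends e → e ≠ e₁ → p e = 0 := by
          intro e he hne
          by_contra hpe
          rcases H e he hpe with h | h
          · exact hne (Hb e e₁ h he₁ hpe hp₁)
          · exact hne ((Ho e e₂ h he₂ hpe hp₂).trans h12.symm)
        exact ⟨cross_one_marker ends s t w hp o hz he₁ hws hwt hwb hwo,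
          same_one_marker ends s t w hp o hz he₁ hws hwt hwb hwo⟩
      · have hz : ∀ e, w ∈ ends e → e ≠ e₁ → e ≠ e₂ → p e = 0 := by
          intro e he hne₁ hne₂
          by_contra hpe
          rcases H e he hpe with h | h
          · exact hne₁ (Hb e e₁ h he₁ hpe hp₁)
          · exact hne₂ (Ho e e₂ h he₂ hpe hp₂)
        exact ⟨RBTwoMarkers.cross_two_markers_of_zero ends s t w hp hz he₁ he₂ h12 hws hwt hwb hwo,
          RBTwoMarkers.same_two_markers_of_zero ends s t w hp hz he₁ he₂ h12 hws hwt hwb hwo⟩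
    · have hz : ∀ e, w ∈ ends e → e ≠ e₁ → p e = 0 := by
        intro e he hne
        by_contra hpe
        rcases H e he hpe with h | h
        · exact hne (Hb e e₁ h he₁ hpe hp₁)
        · exact ho ⟨e, h, hpe⟩
      exact ⟨cross_one_marker ends s t w hp o hz he₁ hws hwt hwb hwo,
        same_one_marker ends s t w hp o hz he₁ hws hwt hwb hwo⟩
  · by_cases ho : ∃ e, ends e = s(w, o) ∧ p e ≠ 0
    · obtain ⟨e₂, he₂, hp₂⟩ := ho
      have hz : ∀ e, w ∈ ends e → e ≠ e₂ → p e = 0 := by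
        intro e he hne
        by_contra hpe
        rcases H e he hpe with h | h
        · exact hb ⟨e, h, hpe⟩
        · exact hne (Ho e e₂ h he₂ hpe hp₂)
      exact ⟨cross_one_marker_o ends s t w hp b hz he₂ hws hwt hwb hwo,
        same_one_marker_o ends s t w hp b hz he₂ hws hwt hwb hwo⟩
    · have hz : ∀ e, w ∈ ends e → p e = 0 := by
        intro e he
        by_contra hpe
        rcases H e he hpe with h | h
        · exact hb ⟨e, h, hpe⟩
        · exact ho ⟨e, h, hpe⟩
      exact ⟨RBRoot.cross_isolated p ends w hz o b s t, RBRoot.same_isolated p ends w hz o b s t⟩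

/-- **Zeroing the root edges, cross form**: if the row holds after the edges of `F ⊆ {e : ends e ∈
{{w, s}, {w, t}}}` are given weight `0`, it holds for `p` (`RBRootEdge.cross_of_update(_t)`, one
edge at a time). -/
theorem cross_of_zero_roots {p : E → R} (hp : IsProbVec p) (o b : V) (F : Finset E) :
    (∀ e ∈ F, ends e = s(w, s) ∨ ends e = s(w, t)) →
    RBRoot.rbSum (fun e => if e ∈ F then 0 else p e) ends s t w (connEvent ends b s)
        (connEvent ends o t) ≤
      prob (fun e => if e ∈ F then 0 else p e) ((connEvent ends s t)ᶜ ∩ connEvent ends b s) *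
        prob (fun e => if e ∈ F then 0 else p e) ((connEvent ends s t)ᶜ ∩ connEvent ends o t) /
        prob (fun e => if e ∈ F then 0 else p e) (connEvent ends s t)ᶜ →
    RBRoot.rbSum p ends s t w (connEvent ends b s) (connEvent ends o t) ≤
      prob p ((connEvent ends s t)ᶜ ∩ connEvent ends b s) *
        prob p ((connEvent ends s t)ᶜ ∩ connEvent ends o t) / prob p (connEvent ends s t)ᶜ := by
  induction F using Finset.induction_on with
  | empty =>
    intro _ h0
    simpa using h0
  | insert a F ha ih =>
    intro hF h0
    refine ih (fun e he => hF e (Finset.mem_insert_of_mem he)) ?_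
    have hpF : IsProbVec (fun e => if e ∈ F then 0 else p e) :=
      ⟨fun e => by split_ifs; exacts [le_rfl, hp.nonneg e],
       fun e => by split_ifs; exacts [zero_le_one, hp.le_one e]⟩
    have heq : (fun e => if e ∈ insert a F then 0 else p e) =
        Function.update (fun e => if e ∈ F then 0 else p e) a 0 := by
      funext e
      by_cases h : e = a
      · subst h; simp
      · rw [Function.update_of_ne h]; simp [h]
    rw [heq] at h0
    rcases hF a (Finset.mem_insert_self a F) with hs | ht
    · exact RBRootEdge.cross_of_update ends hpF hs h0
    · exact RBRootEdge.cross_of_update_t ends s t w hpF ht h0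

/-- **Zeroing the root edges, same form** (`RBRootEdge.same_of_update(_t)`). -/
theorem same_of_zero_roots {p : E → R} (hp : IsProbVec p) (o b : V) (F : Finset E) :
    (∀ e ∈ F, ends e = s(w, s) ∨ ends e = s(w, t)) →
    prob (fun e => if e ∈ F then 0 else p e) ((connEvent ends s t)ᶜ ∩ connEvent ends b s) *
        prob (fun e => if e ∈ F then 0 else p e) ((connEvent ends s t)ᶜ ∩ connEvent ends o s) /
        prob (fun e => if e ∈ F then 0 else p e) (connEvent ends s t)ᶜ ≤
      RBRoot.rbSum (fun e => if e ∈ F then 0 else p e) ends s t w (connEvent ends b s)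
        (connEvent ends o s) →
    prob p ((connEvent ends s t)ᶜ ∩ connEvent ends b s) *
        prob p ((connEvent ends s t)ᶜ ∩ connEvent ends o s) / prob p (connEvent ends s t)ᶜ ≤
      RBRoot.rbSum p ends s t w (connEvent ends b s) (connEvent ends o s) := by
  induction F using Finset.induction_on with
  | empty =>
    intro _ h0
    simpa using h0
  | insert a F ha ih =>
    intro hF h0
    refine ih (fun e he => hF e (Finset.mem_insert_of_mem he)) ?_
    have hpF : IsProbVec (fun e => if e ∈ F then 0 else p e) :=
      ⟨fun e => by split_ifs; exacts [le_rfl, hp.nonneg e],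
       fun e => by split_ifs; exacts [zero_le_one, hp.le_one e]⟩
    have heq : (fun e => if e ∈ insert a F then 0 else p e) =
        Function.update (fun e => if e ∈ F then 0 else p e) a 0 := by
      funext e
      by_cases h : e = a
      · subst h; simp
      · rw [Function.update_of_ne h]; simp [h]
    rw [heq] at h0
    rcases hF a (Finset.mem_insert_self a F) with hs | ht
    · exact RBRootEdge.same_of_update ends hpF hs h0
    · exact RBRootEdge.same_of_update_t ends s t w hpF ht h0

/-- **THE KERNEL THEOREM — row 2′RB at every third vertex whose neighbours are roots and
markers** (MINE-A.md §30–§32 (b)): `w ∉ {s, t, b, o}`, every edge of nonzero weight at `w` ends in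
`{s, t, b, o}`, at most one such edge to `b` and at most one to `o`. Both forms of the row hold
at `w`. -/
theorem rb_of_skeleton {p : E → R} (hp : IsProbVec p) (o b : V)
    (H : ∀ e, w ∈ ends e → p e ≠ 0 →
      ends e = s(w, s) ∨ ends e = s(w, t) ∨ ends e = s(w, b) ∨ ends e = s(w, o))
    (Hb : ∀ e e', ends e = s(w, b) → ends e' = s(w, b) → p e ≠ 0 → p e' ≠ 0 → e = e')
    (Ho : ∀ e e', ends e = s(w, o) → ends e' = s(w, o) → p e ≠ 0 → p e' ≠ 0 → e = e')
    (hws : s ≠ w) (hwt : t ≠ w) (hwb : b ≠ w) (hwo : o ≠ w) :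
    (RBRoot.rbSum p ends s t w (connEvent ends b s) (connEvent ends o t) ≤
      prob p ((connEvent ends s t)ᶜ ∩ connEvent ends b s) *
        prob p ((connEvent ends s t)ᶜ ∩ connEvent ends o t) / prob p (connEvent ends s t)ᶜ) ∧
    (prob p ((connEvent ends s t)ᶜ ∩ connEvent ends b s) *
        prob p ((connEvent ends s t)ᶜ ∩ connEvent ends o s) / prob p (connEvent ends s t)ᶜ ≤
      RBRoot.rbSum p ends s t w (connEvent ends b s) (connEvent ends o s)) := by
  set F : Finset E := Finset.univ.filter (fun e => ends e = s(w, s) ∨ ends e = s(w, t)) with hF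
  have hFmem : ∀ e ∈ F, ends e = s(w, s) ∨ ends e = s(w, t) := fun e he => (Finset.mem_filter.1 he).2
  have hpF : IsProbVec (fun e => if e ∈ F then 0 else p e) :=
    ⟨fun e => by split_ifs; exacts [le_rfl, hp.nonneg e],
     fun e => by split_ifs; exacts [zero_le_one, hp.le_one e]⟩
  have hne : ∀ e, (if e ∈ F then 0 else p e) ≠ 0 → e ∉ F ∧ p e ≠ 0 := by
    intro e h
    by_cases hF' : e ∈ F
    · rw [if_pos hF'] at h; exact absurd rfl h
    · rw [if_neg hF'] at h; exact ⟨hF', h⟩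
  have H' : ∀ e, w ∈ ends e → (if e ∈ F then 0 else p e) ≠ 0 →
      ends e = s(w, b) ∨ ends e = s(w, o) := by
    intro e he h
    obtain ⟨hnF, hpe⟩ := hne e h
    rcases H e he hpe with hs | ht | hb | ho
    · exact absurd (Finset.mem_filter.2 ⟨Finset.mem_univ e, Or.inl hs⟩) hnF
    · exact absurd (Finset.mem_filter.2 ⟨Finset.mem_univ e, Or.inr ht⟩) hnF
    · exact Or.inl hb
    · exact Or.inr ho
  have Hb' : ∀ e e', ends e = s(w, b) → ends e' = s(w, b) → (if e ∈ F then 0 else p e) ≠ 0 →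
      (if e' ∈ F then 0 else p e') ≠ 0 → e = e' :=
    fun e e' h h' hpe hpe' => Hb e e' h h' (hne e hpe).2 (hne e' hpe').2
  have Ho' : ∀ e e', ends e = s(w, o) → ends e' = s(w, o) → (if e ∈ F then 0 else p e) ≠ 0 →
      (if e' ∈ F then 0 else p e') ≠ 0 → e = e' :=
    fun e e' h h' hpe hpe' => Ho e e' h h' (hne e hpe).2 (hne e' hpe').2
  obtain ⟨hc, hs⟩ := rb_of_markers ends s t w hpF o b H' Hb' Ho' hws hwt hwb hwo
  exact ⟨cross_of_zero_roots ends s t w hp o b F hFmem hc,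
    same_of_zero_roots ends s t w hp o b F hFmem hs⟩

end Kernel

end RBKernel

end Summit.Ventures.PercRepro2
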